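import Summits.HodgeConjecture.CorCM.HypD3.A4LiuD3Items
import Literature.NumberTheory.Automorphic.Liu2021.Thm418AsPrinted
import HarnessLib

/-!
# Line `a3-liu418`, row III-11 (`stub_epsRigidAtFace`): the TYPES of the road's residual facts — the local Galois twist of a member of the
# family of record, the cyclotomic unit is a local norm, and a prescribed local square class is globally represented

Summits side, binder subdirectory `CorCM/HypLiu418/` (cell `hodgecm-mathlib`, fan A, rung A-III; crux item stmt-HodgeConjecture-24832, registered residual
`stub_epsRigidAtFace : EpsRigidAtFace` of `Cruxes/HLiu418/Lines/a3_liu418.lean` v8 :356 = row III-11 `Thm418Data.EpsRigidUnderGaloisTwist` at the face).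
DEFINITIONS ONLY (four closed `Prop`s), nothing asserted, no `sorry`: the BINDER TYPES of the closing theorem
`epsRigidAtFace_of_localTwist (hT : LocalTypeGaloisTwist) (hN : CyclotomicUnitIsLocalNormOdd) (hN₂ : CyclotomicUnitIsLocalNormDyadic)
(hS : PrescribedLocalSquareClass) : EpsRigidAtFace`
(A-p19, `CorCM/HypLiu418/A3Liu418EpsRigidAtFace.lean`, road memo `A-provers/A-p19/ROAD-III11-v2.md` af743dc36c4b04cf, director g2 BATCH 28/36 «memo of record»),
stated BY NAME so that the fan-B hands close them with `theorem … : LocalTypeGaloisTwist` etc. (pattern of ✔ `A4LiuD3Items.lean` / ✔ `A3Liu418FaceTypes.lean`).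
All are in the currency of the family of record `famAtV F e₁ dV hdV hdV0 ψ hψ aOf χOf v` (✔ `A4LiuD3Items.lean`): an ARBITRARY index type `ι`, so
that the auxiliary line `t · a` of the Galois-twist argument is simply another member.

THE MATHEMATICS ([Liu2021, Thm. 4.18 (3)], proof l. 2272–2289, read through the doubling normalisation of the tree's μ-attached splitting).  For
`σ ∈ Aut(ℂ/M_μ)` the `σ`-twist of the local oscillator type `X_v(μ, a, χ)` (member `(a, χ)` of the μ-family at `v`) is the member
`X_v(μ, t·a, χ^σ)` for any global `t` in the local square class of the cyclotomic unit `κ_σ` (`σ ∘ ψ_v = ψ_v(κ_σ ·)`): the μ-normalised doubled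
Weil representation has Siegel scalar `μ(det)·|det|^{1/2} = μ^{alg}(det)·‖det‖ ∈ M_μ · ℚ`, fixed by `σ`, so only `ψ_v ↦ ψ_v(κ_σ ·)` moves, i.e. the
line `⟨a⟩ ↦ ⟨κ_σ a⟩ ≅ ⟨t a⟩` — `LocalTypeGaloisTwist`.  The separation of collections is then [Lem. D.1 (3)]'s `ε`-clause (✔
`HypD3.sameClassChiOfIsoNonsplit_holds` with ✔ `rankOne_theta_lines_disjoint_holds`), and `κ_σ ∈ Nm E_w^×` at non-split `w` for `σ ∈ Aut(ℂ/M_μ)` —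
`CyclotomicUnitIsLocalNormOdd ∕ …Dyadic` (the number-theoretic core l. 2272–2289: [BH06 41.2 (2)] ∕ Serre ∕ O'Meara; tree: A-p11 `Thm418MuFieldContainsNormField`,
`Thm418CyclotomicSquareRoots`, B-p13 `AdelicAdditiveCharacterGaloisTwist`).  `PrescribedLocalSquareClass` is the elementary supplier of `t`
(density of `F⁺` in `F⁺_v` + Hensel for squares).

HC_CM is proved only modulo the 7 printed citations (`hDel`, `h21`, `hLiu418`, `h411`, `h413`, `hD3`, `hD1''`) until rung 0 closes; this file proves
nothing and discharges nothing.

## References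
* [Liu2021] Y. Liu, Camb. J. Math. 9 (2021) = arXiv:2102.11518 — Thm. 4.18 (3) (l. 2243) with proof l. 2272–2289; Def. 4.11–4.12; App. D Lem. D.1 (3).
* [BushnellHenniart2006] Prop. 41.2 (2) (as cited by Liu; not held).  [HarrisKudlaSweet1996] §1 (splittings).  [Kudla1994] Thm. 3.1.
-/

set_option autoImplicit false

noncomputable section

namespace Summit.HodgeConjecture.CorCM.Lines.A3Liu418

open scoped TensorProduct Matrix
open NumberField NumberField.InfinitePlace
open Literature.NumberTheory.ComplexMultiplication
open Literature.NumberTheory.Automorphic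
open Literature.NumberTheory.Automorphic.IdeleClassGroup (toHeckeCharacter isUnitary_toHeckeCharacter)
open Literature.NumberTheory.Automorphic.Liu2021
open HodgeCM.Model.ArchSideTerm (e₁)
open Literature.NumberTheory.GelbartRogawski1991 Literature.NumberTheory.GelbartRogawski1991.UnitaryDualPair
open Literature.RepresentationTheory Literature.RepresentationTheory.Liu2021
open Summit.HodgeConjecture.CorCM.Lines.A4LiuD3 (famAtV)

/-- **ROAD PIECE P3 (+P4) — THE LOCAL GALOIS TWIST OF A MEMBER IS A MEMBER.**  For the family of record `famAtV F e₁ dV … ψ hψ aOf χOf v` at a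
NON-SPLIT finite place `v` of `F⁺` and two members `i₀`, `i₁` with the SAME label `ψ i₁ = ψ i₀ =: μ`: if `σ : ℂ ≃+* ℂ` fixes the field of values
`M_μ` (l. 1928), `σ ∘ ψ_v = ψ_v(κ ·)` (`κ` the cyclotomic unit of `σ` at `v`), the lines satisfy `a_{i₁} = t · a_{i₀}` with `s² t = κ` in `F⁺_v`
(`t` in the local square class of `κ`), and `χ_{i₁} = σ ∘ χ_{i₀}`, then there is a BIJECTIVE `σ`-SEMILINEAR `U(J_V)(F⁺_v)`-equivariant map from
the local type of member `i₀` to the local type of member `i₁` (`X_v(μ, a, χ)^σ ≅ X_v(μ, t a, χ^σ)`): the μ-normalised doubled Weil representation is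
`σ`-stable (Siegel scalar `μ(det)|det|^{1/2} = μ^{alg}(det)‖det‖ ∈ M_μ·ℚ`), `σ` acts on the Schrödinger model by `Φ ↦ σ ∘ Φ` and moves only
`ψ_v ↦ ψ_v(κ·)` ([MVW87, Chap. 2 II Rem. (2)]: the `ψ(κ·)`-Weil representation of `β` is the `ψ`-one of `κ•β`), and `κ•β_{⟨a⟩} ≅ β_{⟨t a⟩}` by the
dilation `x ↦ s x`.  Conclusion shape = `Literature.RepresentationTheory.Semisimple.AreSemilinearIso (σ : ℂ →+* ℂ) (quot i₀) (quot i₁)` unfolded.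
Nothing asserted. [cite: Liu2021, Thm. 4.18 (3) with proof l. 2272–2289; Def. 4.11 (l. 2092–2096)] [cite: MoeglinVignerasWaldspurger1987, Chap. 2 II.1 and Remarque (2)]
[cite: HarrisKudlaSweet1996, §1 (1.14)–(1.15)] -/
def LocalTypeGaloisTwist : Prop :=
  ∀ (F : HodgeCM.CMField) (dV : Fin 3 → (F : Type))
      (hdV : ∀ i, IsCMField.complexConj (F : Type) (dV i) = dV i) (hdV0 : ∀ i, dV i ≠ 0) {ι : Type}
      (ψ : ι → (Literature.NumberTheory.Automorphic.IdeleClassGroup (F : Type) →ₜ* Circle))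
      (hψ : ∀ t, IdeleClassGroup.IsConjugateSymplectic (F : Type) (ψ t))
      (aOf : ι → (↥(maximalRealSubfield (F : Type)))ˣ)
      (χOf : ι → Def411WeilCarriers.Chi ↥(maximalRealSubfield (F : Type)) (F : Type) (IsCMField.complexConj (F : Type)))
      (v : IsDedekindDomain.HeightOneSpectrum (𝓞 ↥(maximalRealSubfield (F : Type)))),
      IsField (UnitaryGroup.LocalRing (F : Type) v) →
      ∀ (i₀ i₁ : ι), ψ i₁ = ψ i₀ →
      ∀ (σ : ℂ ≃+* ℂ), (∀ z : ℂ, z ∈ Liu2021.fieldOfValues (F : Type) (ψ i₀) → σ z = z) →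
      ∀ (κ : v.adicCompletion ↥(maximalRealSubfield (F : Type))),
        (∀ r : v.adicCompletion ↥(maximalRealSubfield (F : Type)),
            σ ((adeleAddCharAt ↥(maximalRealSubfield (F : Type)) v r : Circle) : ℂ) =
              ((adeleAddCharAt ↥(maximalRealSubfield (F : Type)) v (κ * r) : Circle) : ℂ)) →
      ∀ (s : (v.adicCompletion ↥(maximalRealSubfield (F : Type)))ˣ),
        (s : v.adicCompletion ↥(maximalRealSubfield (F : Type))) * s *
            algebraMap ↥(maximalRealSubfield (F : Type)) (v.adicCompletion ↥(maximalRealSubfield (F : Type)))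
              (((aOf i₁ : (↥(maximalRealSubfield (F : Type)))ˣ) : ↥(maximalRealSubfield (F : Type))) *
                ((aOf i₀ : (↥(maximalRealSubfield (F : Type)))ˣ) : ↥(maximalRealSubfield (F : Type)))⁻¹) = κ →
        (∀ u, ((((χOf i₁).1 u : ℂˣ)) : ℂ) = σ (((χOf i₀).1 u : ℂˣ) : ℂ)) →
        ∃ h : _ →ₛₗ[(σ : ℂ →+* ℂ)] _, Function.Bijective h ∧
          ∀ g x, h ((famAtV F e₁ dV hdV hdV0 ψ hψ aOf χOf v).quot i₀ g x) = (famAtV F e₁ dV hdV hdV0 ψ hψ aOf χOf v).quot i₁ g (h x)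

/-- **ROAD PIECE P6, ODD RESIDUE CHARACTERISTIC — THE CYCLOTOMIC UNIT OF `σ ∈ Aut(ℂ/M_μ)` IS A LOCAL NORM AT EVERY NON-SPLIT `v ∤ 2`**
([Liu2021] proof of Thm. 4.18 (3), l. 2272–2279: «the image of `Gal(ℂ/M_μ)` under the `p`-adic cyclotomic character `χ_p` is contained in
`ℤ_p^× ∩ Nm_{E_𝔭/F_𝔭} E_𝔭^×` for every prime `𝔭` of `F` above `p`», case `p` odd): for `μ` conjugate symplectic of weight one, `σ : ℂ ≃+* ℂ` fixing
`M_μ = fieldOfValues F μ`, `v ∤ 2` non-split in `F/F⁺` and `κ ∈ F⁺_v` with `σ ∘ ψ_v = ψ_v(κ ·)`, the element `κ` is a norm from `F_w` — in the tree's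
local-norm currency of `localIndexedFamilyAtV`'s `hμF` (`∃ x : (UnitaryGroup.LocalRing F v)ˣ, x · x̄ = κ`).  Inert `w`: `κ` is a unit and units are
norms; ramified `w`: `√c ∈ M_μ` (✔ A-p11 `exists_mem_fieldOfValues_sq_eq`), the cyclotomic reading of `σ √c = √c` (✔ `Thm418CyclotomicSquareRoots`)
and the local norm criterion at odd `p` (✔ A-p11 p610811).  Split from the dyadic case at A-p11's request (2026-08-28T07:06:31Z): the odd case closes by
name unconditionally.  Nothing asserted. [cite: Liu2021, Thm. 4.18 (3), proof l. 2272–2279] -/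
def CyclotomicUnitIsLocalNormOdd : Prop :=
  ∀ (F : HodgeCM.CMField) (μ : Literature.NumberTheory.Automorphic.IdeleClassGroup (F : Type) →ₜ* Circle),
      IdeleClassGroup.IsConjugateSymplectic (F : Type) μ → IdeleClassGroup.HasWeight (F : Type) μ 1 →
      ∀ (σ : ℂ ≃+* ℂ), (∀ z : ℂ, z ∈ Liu2021.fieldOfValues (F : Type) μ → σ z = z) →
      ∀ (v : IsDedekindDomain.HeightOneSpectrum (𝓞 ↥(maximalRealSubfield (F : Type)))),
        (2 : 𝓞 ↥(maximalRealSubfield (F : Type))) ∉ v.asIdeal →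
        IsField (UnitaryGroup.LocalRing (F : Type) v) →
      ∀ (κ : v.adicCompletion ↥(maximalRealSubfield (F : Type))),
        (∀ r : v.adicCompletion ↥(maximalRealSubfield (F : Type)),
            σ ((adeleAddCharAt ↥(maximalRealSubfield (F : Type)) v r : Circle) : ℂ) =
              ((adeleAddCharAt ↥(maximalRealSubfield (F : Type)) v (κ * r) : Circle) : ℂ)) →
        ∃ x : (UnitaryGroup.LocalRing (F : Type) v)ˣ,
          (x : UnitaryGroup.LocalRing (F : Type) v) * UnitaryGroup.conjLocal (F : Type) (IsCMField.complexConj (F : Type)) v x =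
            algebraMap (v.adicCompletion ↥(maximalRealSubfield (F : Type))) (UnitaryGroup.LocalRing (F : Type) v) κ

/-- **ROAD PIECE P6, DYADIC — THE CYCLOTOMIC UNIT OF `σ ∈ Aut(ℂ/M_μ)` IS A LOCAL NORM AT EVERY NON-SPLIT `v ∣ 2`** ([Liu2021] proof of Thm. 4.18 (3),
l. 2281–2289, case `p = 2`: Eisenstein polynomial, `d := min{2 v_F(a) − 1, v_F(4)}`, the three fields `M_{E/F} = ℚ(√−1), ℚ(√2), ℚ(√−2)`, «[BH06,
Prop. 41.2 (2)]» twice; lit1's caveat on the printed sentence l. 2283 for even `f(F/ℚ₂)` is recorded in `Thm418EpsRigidUnderGaloisTwist.lean` —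
the STATEMENT is unaffected): same text as `CyclotomicUnitIsLocalNormOdd` with `(2 : 𝓞 F⁺) ∈ v.asIdeal`.  Closes modulo the local-CFT input at `2`
(`QuadraticForms.HilbertSymbolNormCompatAtTwo`, A-p11).  Nothing asserted.
[cite: Liu2021, Thm. 4.18 (3), proof l. 2281–2289] [cite: BushnellHenniart2006, §41.2 Prop. (2) (as cited by Liu l. 2283, 2285; not held)] -/
def CyclotomicUnitIsLocalNormDyadic : Prop :=
  ∀ (F : HodgeCM.CMField) (μ : Literature.NumberTheory.Automorphic.IdeleClassGroup (F : Type) →ₜ* Circle),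
      IdeleClassGroup.IsConjugateSymplectic (F : Type) μ → IdeleClassGroup.HasWeight (F : Type) μ 1 →
      ∀ (σ : ℂ ≃+* ℂ), (∀ z : ℂ, z ∈ Liu2021.fieldOfValues (F : Type) μ → σ z = z) →
      ∀ (v : IsDedekindDomain.HeightOneSpectrum (𝓞 ↥(maximalRealSubfield (F : Type)))),
        (2 : 𝓞 ↥(maximalRealSubfield (F : Type))) ∈ v.asIdeal →
        IsField (UnitaryGroup.LocalRing (F : Type) v) →
      ∀ (κ : v.adicCompletion ↥(maximalRealSubfield (F : Type))),
        (∀ r : v.adicCompletion ↥(maximalRealSubfield (F : Type)),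
            σ ((adeleAddCharAt ↥(maximalRealSubfield (F : Type)) v r : Circle) : ℂ) =
              ((adeleAddCharAt ↥(maximalRealSubfield (F : Type)) v (κ * r) : Circle) : ℂ)) →
        ∃ x : (UnitaryGroup.LocalRing (F : Type) v)ˣ,
          (x : UnitaryGroup.LocalRing (F : Type) v) * UnitaryGroup.conjLocal (F : Type) (IsCMField.complexConj (F : Type)) v x =
            algebraMap (v.adicCompletion ↥(maximalRealSubfield (F : Type))) (UnitaryGroup.LocalRing (F : Type) v) κ

/-- **ROAD PIECE P5 — A PRESCRIBED LOCAL SQUARE CLASS OF UNITS IS GLOBALLY REPRESENTED**: for a number field `K`, a finite place `v` and a unit `κ` of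
`K_v` (`Valued.v κ = 1`), there are a GLOBAL `t ∈ Kˣ` and `s ∈ K_vˣ` with `s² · t = κ` — `K` is dense in `K_v` and `1 + 𝔭_vᴺ ⊆ (K_vˣ)²` for `N`
large (Hensel).  Elementary; nothing asserted here. [cite: CasselsFrohlichANT1967, Ch. II §6 and §10 (completions; Hensel)] -/
def PrescribedLocalSquareClass : Prop :=
  ∀ (K : Type) [Field K] [NumberField K] (v : IsDedekindDomain.HeightOneSpectrum (𝓞 K)) (κ : v.adicCompletion K),
    Valued.v κ = 1 →
      ∃ (t : Kˣ) (s : (v.adicCompletion K)ˣ),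
        (s : v.adicCompletion K) * s * algebraMap K (v.adicCompletion K) ((t : Kˣ) : K) = κ

end Summit.HodgeConjecture.CorCM.Lines.A3Liu418

end
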